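import Summits.Ventures.HodgeRepro2.CyclotomicSevenTypes
import Summits.Ventures.HodgeRepro2.T5DatumCMField
import Summits.Ventures.HodgeRepro2.T5FinitePlaceBinaryUniversal

/-!
# `ℚ(ζ₇)`: every non-split finite place of `ℚ(ζ₇)⁺` is non-dyadic, so `(U)` and Lemma 1.6 hold there
with no binder (cell pub-hodge-repro2, seat p3)

Tier-5 N2 support, rows N2.2.2 / N2.8.1 of route/T5-N2-route-3.md, on the field of record `K7 = ℚ(ζ₇)`
(p1's `CyclotomicSeven.K7`, the sextic Galois CM field of the Tier-4/5 instantiation) with `F = K7⁺` Mathlib's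
`maximalRealSubfield K7`. File 143 proved `(U) = BinaryUniversal E_w` at the non-split places `v ∤ 2`. Here the
dyadic place is shown to SPLIT in `K7/K7⁺`, through an explicit square root of `−7`:

* `sqrtNegSeven = 1 + 2(ζ + ζ² + ζ⁴)` with `sqrtNegSeven ^ 2 = −7` (the cyclotomic identity from `ζ⁷ = 1` and
  `1 + ζ + ⋯ + ζ⁶ = 0`) and `complexConj sqrtNegSeven = −sqrtNegSeven` (from `complexConj ζ = ζ⁻¹`);
* `exists_eq_neg_seven_mul_sq`: every anti-invariant `y` (`complexConj y = −y`) has `y² = −7 r²` with `r ∈ K7⁺`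
  (`y / sqrtNegSeven` is fixed by the conjugation);
* `isSquare_neg_seven_of_not_isUnit_two`: at a place `v ∣ 2` of `K7⁺`, `−7 = 1 + 4·(−2)` is a square of
  `O_{F_v}` (seat p4's Hensel square `T5NormGroupOpen.exists_sq_eq_of_sub_one_mem_four_mul`);
* **`isUnit_two_of_not_isSquare`**: if `θ = s²` (`s ∈ K7`) is NOT a `v`-adic square then `2 ∈ O_{F_v}^×` — every
  non-split place of `K7⁺` in `K7` is non-dyadic (the dyadic place splits);
* **`binaryUniversal_K7`**, `isCongruent_iff_exists_det_eq_K7`, `isCongruent_iff_hilbertSolvable_K7`,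
  `exists_two_classes_K7`: on the route's field of record, `(U)`, Shimura's Lemma 1.6, row N2.8.1 (i) and HKS96's
  «precisely two classes» hold on `E_w` at EVERY finite non-split place with NO binder.

Mathlib + p1's `CyclotomicSevenTypes` (`zeta7`, `isPrimitiveRoot_zeta7`, `star_zeta7`), this seat's
`T5DatumCMField` (`star_eq_complexConj`) and files 141–143 (with seat p4's chain through them) only; no display;
no device. §8(d): uses an L-value-free non-vanishing device: NO.
-/

namespace Summit.Ventures.HodgeRepro2.T5CyclotomicSevenNonDyadic

open IsDedekindDomain IsDedekindDomain.HeightOneSpectrum NumberField NumberField.IsCMField Module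
open Summit.Ventures.HodgeRepro2.CyclotomicSeven Summit.Ventures.HodgeRepro2.T5DatumCMField
  Summit.Ventures.HodgeRepro2.T5FinitePlaceStar Summit.Ventures.HodgeRepro2.T5HilbertSymbolNorm
  Summit.Ventures.HodgeRepro2.T5HermitianDetClass Summit.Ventures.HodgeRepro2.T5HermitianClassify
  Summit.Ventures.HodgeRepro2.T5FinitePlaceBinaryUniversal

section SquareRoot

/-- `√−7 = 1 + 2(ζ₇ + ζ₇² + ζ₇⁴) ∈ ℚ(ζ₇)` (the quadratic Gauss period). -/
noncomputable def sqrtNegSeven : K7 := 1 + 2 * (zeta7 + zeta7 ^ 2 + zeta7 ^ 4)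

/-- `ζ₇ ^ 7 = 1`. -/
theorem zeta7_pow_seven : zeta7 ^ 7 = 1 := isPrimitiveRoot_zeta7.pow_eq_one

/-- `1 + ζ₇ + ζ₇² + ζ₇³ + ζ₇⁴ + ζ₇⁵ + ζ₇⁶ = 0`. -/
theorem zeta7_geom_sum :
    1 + zeta7 + zeta7 ^ 2 + zeta7 ^ 3 + zeta7 ^ 4 + zeta7 ^ 5 + zeta7 ^ 6 = 0 := by
  have h := isPrimitiveRoot_zeta7.geom_sum_eq_zero (by norm_num)
  simp only [Finset.sum_range_succ, Finset.sum_range_zero, pow_zero, zero_add] at h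
  linear_combination h

/-- **`sqrtNegSeven ^ 2 = −7`.** -/
theorem sqrtNegSeven_sq : sqrtNegSeven ^ 2 = -7 := by
  unfold sqrtNegSeven
  linear_combination 8 * zeta7_geom_sum + 4 * zeta7 * zeta7_pow_seven

/-- `sqrtNegSeven ≠ 0`. -/
theorem sqrtNegSeven_ne_zero : sqrtNegSeven ≠ 0 := by
  intro h
  have := sqrtNegSeven_sq
  rw [h, zero_pow two_ne_zero] at this
  have h7 : (7 : K7) ≠ 0 := by norm_num
  exact h7 (by linear_combination this)

/-- `ζ₇⁻¹ = ζ₇ ^ 6`. -/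
theorem zeta7_inv_eq : zeta7⁻¹ = zeta7 ^ 6 :=
  inv_eq_of_mul_eq_one_right (by rw [← pow_succ']; exact zeta7_pow_seven)

/-- `(ζ₇ ^ 2)⁻¹ = ζ₇ ^ 5`. -/
theorem zeta7_sq_inv_eq : (zeta7 ^ 2)⁻¹ = zeta7 ^ 5 :=
  inv_eq_of_mul_eq_one_right (by rw [← pow_add]; exact zeta7_pow_seven)

/-- `(ζ₇ ^ 4)⁻¹ = ζ₇ ^ 3`. -/
theorem zeta7_pow_four_inv_eq : (zeta7 ^ 4)⁻¹ = zeta7 ^ 3 :=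
  inv_eq_of_mul_eq_one_right (by rw [← pow_add]; exact zeta7_pow_seven)

/-- **The conjugation negates `√−7`:** `star sqrtNegSeven = −sqrtNegSeven` (star = Mathlib's `complexConj`). -/
theorem star_sqrtNegSeven : star sqrtNegSeven = -sqrtNegSeven := by
  unfold sqrtNegSeven
  rw [star_add, star_one, star_mul, star_ofNat, star_add, star_add, star_pow, star_pow, star_zeta7, inv_pow,
    inv_pow, zeta7_inv_eq, zeta7_sq_inv_eq, zeta7_pow_four_inv_eq]
  linear_combination 2 * zeta7_geom_sum

/-- `complexConj sqrtNegSeven = −sqrtNegSeven`. -/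
theorem complexConj_sqrtNegSeven : complexConj K7 sqrtNegSeven = -sqrtNegSeven := by
  rw [← star_eq_complexConj]
  exact star_sqrtNegSeven

end SquareRoot

section Datum

/-- **Every anti-invariant element of `ℚ(ζ₇)` has square `−7 r²` with `r ∈ ℚ(ζ₇)⁺`:** for `y` with
`complexConj y = −y` and `θ ∈ K7⁺` with `θ = y²`, `θ = −7 r²`. -/
theorem exists_eq_neg_seven_mul_sq {θ : maximalRealSubfield K7} {y : K7}
    (hθ : algebraMap (maximalRealSubfield K7) K7 θ = y ^ 2) (hy : complexConj K7 y = -y) :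
    ∃ r : maximalRealSubfield K7, θ = -7 * r ^ 2 := by
  have hfix : complexConj K7 (y / sqrtNegSeven) = y / sqrtNegSeven := by
    rw [map_div₀, hy, complexConj_sqrtNegSeven, neg_div_neg_eq]
  have hmem : y / sqrtNegSeven ∈ maximalRealSubfield K7 := (complexConj_eq_self_iff K7 _).1 hfix
  refine ⟨⟨y / sqrtNegSeven, hmem⟩, (algebraMap (maximalRealSubfield K7) K7).injective ?_⟩
  rw [hθ, map_mul, map_neg, map_ofNat, map_pow]
  change y ^ 2 = -7 * (y / sqrtNegSeven) ^ 2
  rw [← sqrtNegSeven_sq, div_pow, mul_div_cancel₀ _ (pow_ne_zero 2 sqrtNegSeven_ne_zero)]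

/-- If `s ^ 2 = θ` with `θ ∈ K7⁺` not a `v`-adic square, then `s` is anti-invariant (`complexConj s = −s`):
`(complexConj s)² = s²` and `complexConj s = s` would put `s`, hence a square root of `θ`, in `K7⁺`. -/
theorem complexConj_eq_neg_of_not_isSquare (v : HeightOneSpectrum (𝓞 (maximalRealSubfield K7)))
    {s : K7} {θ : maximalRealSubfield K7} (hs : s ^ 2 = algebraMap (maximalRealSubfield K7) K7 θ)
    (hsq : ¬ IsSquare (algebraMap (maximalRealSubfield K7) (v.adicCompletion (maximalRealSubfield K7)) θ)) :
    complexConj K7 s = -s := by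
  have hsq' : (complexConj K7 s) ^ 2 = s ^ 2 := by
    rw [← map_pow, hs]
    exact complexConj_apply_eq_self K7 θ
  rcases sq_eq_sq_iff_eq_or_eq_neg.1 hsq' with h | h
  · exfalso
    apply hsq
    obtain ⟨s', hs'⟩ : ∃ s' : maximalRealSubfield K7, algebraMap (maximalRealSubfield K7) K7 s' = s :=
      ⟨⟨s, (complexConj_eq_self_iff K7 s).1 h⟩, rfl⟩
    have hθ : θ = s' ^ 2 := (algebraMap (maximalRealSubfield K7) K7).injective (by rw [map_pow, hs', hs])
    exact ⟨algebraMap (maximalRealSubfield K7) (v.adicCompletion (maximalRealSubfield K7)) s',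
      by rw [hθ, map_pow, sq]⟩
  · exact h

end Datum

section Dyadic

variable (v : HeightOneSpectrum (𝓞 (maximalRealSubfield K7)))

/-- At a place `v ∣ 2` (`2` not a unit of `O_{F_v}`), `−2` lies in the maximal ideal. -/
theorem neg_two_mem_maximalIdeal (h2 : ¬ IsUnit (2 : adicCompletionIntegers (maximalRealSubfield K7) v)) :
    (-2 : adicCompletionIntegers (maximalRealSubfield K7) v) ∈
      IsLocalRing.maximalIdeal (adicCompletionIntegers (maximalRealSubfield K7) v) := by
  rw [T5AdicCompletionResidueField.mem_maximalIdeal_iff]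
  rw [adicCompletionIntegers.isUnit_iff_valued_eq_one] at h2
  have hle : Valued.v ((2 : adicCompletionIntegers (maximalRealSubfield K7) v) :
      v.adicCompletion (maximalRealSubfield K7)) ≤ 1 :=
    (mem_adicCompletionIntegers _ _ _).1 (2 : adicCompletionIntegers (maximalRealSubfield K7) v).2
  rw [show ((-2 : adicCompletionIntegers (maximalRealSubfield K7) v) :
      v.adicCompletion (maximalRealSubfield K7)) = -((2 : adicCompletionIntegers (maximalRealSubfield K7) v) :
        v.adicCompletion (maximalRealSubfield K7)) from rfl, Valuation.map_neg]
  exact lt_of_le_of_ne hle h2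

/-- **`−7` is a `v`-adic square at every dyadic place** (`−7 = 1 + 4·(−2)`, seat p4's Hensel square). -/
theorem isSquare_neg_seven_of_not_isUnit_two
    (h2 : ¬ IsUnit (2 : adicCompletionIntegers (maximalRealSubfield K7) v)) :
    IsSquare (-7 : v.adicCompletion (maximalRealSubfield K7)) := by
  obtain ⟨a, -, ha⟩ := T5NormGroupOpen.exists_sq_eq_of_sub_one_mem_four_mul v
    (-7 : adicCompletionIntegers (maximalRealSubfield K7) v) ⟨-2, neg_two_mem_maximalIdeal v h2, by norm_num⟩
  refine ⟨((1 + 2 * a : adicCompletionIntegers (maximalRealSubfield K7) v) :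
    v.adicCompletion (maximalRealSubfield K7)), ?_⟩
  have h := congrArg Subtype.val ha
  push_cast at h ⊢
  rw [← sq, h]
  norm_cast

/-- **Every non-split place of `ℚ(ζ₇)⁺` in `ℚ(ζ₇)` is non-dyadic:** if `θ = s²` (`s ∈ K7`) is not a `v`-adic
square, then `2` is a unit of `O_{F_v}` — the dyadic place of `K7⁺` splits in `K7`. -/
theorem isUnit_two_of_not_isSquare {s : K7} {θ : maximalRealSubfield K7}
    (hs : s ^ 2 = algebraMap (maximalRealSubfield K7) K7 θ)
    (hsq : ¬ IsSquare (algebraMap (maximalRealSubfield K7) (v.adicCompletion (maximalRealSubfield K7)) θ)) :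
    IsUnit (2 : adicCompletionIntegers (maximalRealSubfield K7) v) := by
  by_contra h2
  apply hsq
  obtain ⟨r, hr⟩ := exists_eq_neg_seven_mul_sq hs.symm (complexConj_eq_neg_of_not_isSquare v hs hsq)
  rw [hr, map_mul, map_neg, map_ofNat, map_pow]
  exact (isSquare_neg_seven_of_not_isUnit_two v h2).mul ⟨_, sq _⟩

end Dyadic

section Consequences

variable (v : HeightOneSpectrum (𝓞 (maximalRealSubfield K7))) (w : HeightOneSpectrum (𝓞 K7))
  [w.asIdeal.LiesOver v.asIdeal]
variable {s : K7} {θ : maximalRealSubfield K7}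
variable (hs : s ^ 2 = algebraMap (maximalRealSubfield K7) K7 θ)
  (hspan : Submodule.span (maximalRealSubfield K7) {(1 : K7), s} = ⊤)
  (hsq : ¬ IsSquare (algebraMap (maximalRealSubfield K7) (v.adicCompletion (maximalRealSubfield K7)) θ))
  (c : K7 ≃ₐ[maximalRealSubfield K7] K7) (hc : c s = -s)

/-- **`(U)` on `ℚ(ζ₇)` at EVERY finite non-split place, with no binder.** -/
theorem binaryUniversal_K7 :
    letI := localStarRing v w hs hspan hsq c hc
    BinaryUniversal (w.adicCompletion K7) :=
  binaryUniversal v w hs hspan hsq c hc (isUnit_two_of_not_isSquare v hs hsq)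

/-- Shimura's Lemma 1.6 on `ℚ(ζ₇)_w`, unconditional at every finite non-split place. -/
theorem isCongruent_iff_exists_det_eq_K7 {ι : Type*} [Fintype ι] [DecidableEq ι]
    {H H' : Matrix ι ι (w.adicCompletion K7)}
    (hH : letI := localStarRing v w hs hspan hsq c hc; H.IsHermitian)
    (hH' : letI := localStarRing v w hs hspan hsq c hc; H'.IsHermitian) (hdet : IsUnit H.det) :
    letI := localStarRing v w hs hspan hsq c hc
    IsCongruent H H' ↔ ∃ u : w.adicCompletion K7, u ≠ 0 ∧ H'.det = star u * u * H.det := by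
  letI := localStarRing v w hs hspan hsq c hc
  exact isCongruent_iff_exists_det_eq_local v w hs hspan hsq c hc (isUnit_two_of_not_isSquare v hs hsq) hH hH'
    hdet

/-- Row N2.8.1 (i) on `ℚ(ζ₇)`, unconditional at every finite non-split place: Gram matrices with
`det H' = a · det H`, `a ∈ F_v^×`, are congruent iff `(a, θ)_v = 1`. -/
theorem isCongruent_iff_hilbertSolvable_K7 {ι : Type*} [Fintype ι] [DecidableEq ι]
    {H H' : Matrix ι ι (w.adicCompletion K7)}
    (hH : letI := localStarRing v w hs hspan hsq c hc; H.IsHermitian)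
    (hH' : letI := localStarRing v w hs hspan hsq c hc; H'.IsHermitian) (hdet : IsUnit H.det)
    {a : v.adicCompletion (maximalRealSubfield K7)} (ha : a ≠ 0)
    (hdet' : H'.det = algebraMap (v.adicCompletion (maximalRealSubfield K7)) (w.adicCompletion K7) a * H.det) :
    letI := localStarRing v w hs hspan hsq c hc
    IsCongruent H H' ↔
      HilbertSolvable a (algebraMap (maximalRealSubfield K7) (v.adicCompletion (maximalRealSubfield K7)) θ) := by
  letI := localStarRing v w hs hspan hsq c hc
  exact isCongruent_iff_hilbertSolvable_local v w hs hspan hsq c hc (isUnit_two_of_not_isSquare v hs hsq) hH hH'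
    hdet ha hdet'

/-- HKS96's «precisely two isomorphism classes in each dimension» on `ℚ(ζ₇)_w`, unconditional at every finite
non-split place. -/
theorem exists_two_classes_K7 (m : ℕ) :
    letI := localStarRing v w hs hspan hsq c hc
    ∃ H₁ H₂ : Matrix (Fin (m + 1)) (Fin (m + 1)) (w.adicCompletion K7),
      H₁.IsHermitian ∧ H₂.IsHermitian ∧ IsUnit H₁.det ∧ IsUnit H₂.det ∧ ¬ IsCongruent H₁ H₂ ∧
        ∀ H : Matrix (Fin (m + 1)) (Fin (m + 1)) (w.adicCompletion K7), H.IsHermitian → IsUnit H.det →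
          IsCongruent H H₁ ∨ IsCongruent H H₂ := by
  letI := localStarRing v w hs hspan hsq c hc
  exact exists_two_classes_local' v w hs hspan hsq c hc (isUnit_two_of_not_isSquare v hs hsq) m

end Consequences

end Summit.Ventures.HodgeRepro2.T5CyclotomicSevenNonDyadic
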